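import Literature.NumberTheory.GaloisRepresentations.WeilGroup
import Literature.NumberTheory.GaloisRepresentations.LocalWeilDatumExtensionValuation
import HarnessLib

/-!
# Discharge of `WeilGroup.weilSubgroup_map_absGaloisRestrict_le` (trunk GalRep, item C7)

D-0014 keeps `Literature/` sorry-free by stating cited results as named facts `def X : Prop`.
This sibling file of `Literature.NumberTheory.GaloisRepresentations.WeilGroup` proves the named
fact `WeilGroup.weilSubgroup_map_absGaloisRestrict_le F E`: for a finite extension `E/F` of
non-archimedean local fields with compatible valuations, the restriction
`Gal(Ē/E) → Gal(F̄/F)` (`absGaloisRestrict F E`) maps the Weil group `W_E` into `W_F`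
(Tate, *Number theoretic background*, Corvallis 1979, (1.4.5)–(1.4.6): "`W_E = Gal(Ē/E) ∩ W_F`").
It is the conjunction of three discharged inputs: `W_E = {σ | ∃ n, IsFrobPow σ n}`
(`mem_weilSubgroup_iff`, with `IsFrobPow.mul_holds`), the degree scaling under restriction
(`IsFrobPow.absGaloisRestrict_holds`: a Frobenius power of exponent `n` for `E` restricts to one
of exponent `f n` for `F` when `q_E = q_F ^ f`), and the existence of the residue degree
`q_E = q_F ^ f(E/F)` (`LocalWeilDatum.residueFieldCard_eq_pow_inertiaDeg`, Serre, *Local Fields*,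
Ch. II §2).

This supplies the hypothesis `h` of `WeilGroup.map F E h`, `LocalArtinData.IsCompatible`,
`WeilDeligneRep.IsInducedFrom` and `LocalEpsilonSystem.induction_degree_zero` for finite `E/F`.

## References

* J. Tate, *Number theoretic background*, Proc. Sympos. Pure Math. XXXIII (Corvallis 1977),
  Part 2, AMS 1979, (1.4.5)–(1.4.6) (`Corvallis1979`).
* J.-P. Serre, *Local Fields*, GTM 67 (1979), Ch. II §2 (`SerreLocalFields1979`).
-/

noncomputable section

namespace Literature.NumberTheory.GaloisRepresentations

namespace WeilGroup

variable (F E : Type*) [Field F] [ValuativeRel F] [TopologicalSpace F]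
  [IsNonarchimedeanLocalField F] [Field E] [ValuativeRel E] [TopologicalSpace E]
  [IsNonarchimedeanLocalField E] [Algebra F E] [FiniteDimensional F E] [ValuativeExtension F E]

/-- **Discharge of `WeilGroup.weilSubgroup_map_absGaloisRestrict_le`**: for a finite extension
`E/F` of non-archimedean local fields with compatible valuations, restriction `Gal(Ē/E) → Gal(F̄/F)`
maps `W_E` into `W_F` — an element of `W_E` is a Frobenius power of some exponent `n`
(`mem_weilSubgroup_iff`), its restriction is a Frobenius power of exponent `f n` with
`q_E = q_F ^ f` (`IsFrobPow.absGaloisRestrict_holds`, `LocalWeilDatum.residueFieldCard_eq_pow_inertiaDeg`),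
hence lies in `W_F`.  Ref: Tate, *Number theoretic background* (Corvallis 1979), (1.4.5)–(1.4.6).
[cite: Corvallis1979, (1.4.5)–(1.4.6)] -/
theorem weilSubgroup_map_absGaloisRestrict_le_holds : weilSubgroup_map_absGaloisRestrict_le F E := by
  rintro _ ⟨σ, hσ, rfl⟩
  obtain ⟨n, hn⟩ := (mem_weilSubgroup_iff IsFrobPow.mul_holds).mp hσ
  exact mem_weilSubgroup_of_isFrobPow
    (IsFrobPow.absGaloisRestrict_holds F hn _ (LocalWeilDatum.residueFieldCard_eq_pow_inertiaDeg F E))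

end WeilGroup

end Literature.NumberTheory.GaloisRepresentations

end
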